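import Summits.QuantumFields.QCD.Theorems.ExtinctionBuildsQCD.Negative.ChiralInertia
import Summits.QuantumFields.QCD.Theorems.ExtinctionBuildsQCD.Negative.WithoutTightCollapse
import Summits.QuantumFields.QCD.Theorems.TiltedFlatness.Negative.MasslessKernel

/-!
# `WindowExtinction` (crux stmt-QuantumFields-8964, route `SpectralDefectExtinction`) — negative-side
# support: Weyl's inequality in counting form and the local step of the spectral flow of `ΓD + mΓ`

Definition-free extract of §5a of the standing disprover's work file
`Summits/QuantumFields/QCD/Cruxes/WindowExtinction/Disproof.lean` (cdisprove cycle 1, 2026-08-16), built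
ON TOP of the sibling disprover's landed toolkit for `ExtinctionBuildsQCD`
(`Negative/ChiralInertia.lean`: `re_form_eq_sum_eigenvalues`, `card_le_card_eigenvalues_of_form_pos`;
`Negative/WithoutTightCollapse.lean`: `sum_norm_sq_pos`; and `TiltedFlatness/Negative/MasslessKernel.lean`:
`star_dotProduct_self_eq`, `star_mulVec_dotProduct_mulVec`) — §1–§4 of the work
file (spectral bounds, EXTINCT-alone vacuity, index `≡ 0` off `[−8,0]`, the TIGHT pin) coincide with that
toolkit and with `Negative/TightPinsLine.lean` and are NOT re-landed.

* `card_filter_lt_neg_le`: for Hermitian `A`, `B` with `|Re v†(B − A)v| ≤ δ Σ‖v‖²` and `σ = ±1`: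
  `#{σλ(A) < −δ} ≤ #{σλ(B) < 0}` (counting stability = Weyl's inequality in counting form).
* `pencil_local`: for the Hermitian pencil `H(m) = ΓD + mΓ` (`Γ` Hermitian unitary, `ΓD` Hermitian) and every
  `m` there is `ε > 0` with `ν(m) ≤ ν(m+t) ≤ ν(m) + κ(m)` and `π(m) ≤ π(m+t)` for `|t| < ε`
  (`ν, π, κ` = negative / positive / zero eigenvalue counts, as roots of the characteristic polynomial).
* `pencil_zero_count_le`: `κ(m) ≤` algebraic multiplicity of `−m` as an eigenvalue of `D`.
The global counting inequality and its Wilson-fermion form are in the sibling file `SpectralFlow.lean`.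
-/

namespace Summit.QuantumFields.QCD.Theorems.WindowExtinction.Negative

open Matrix
open Summit.QuantumFields.QCD.Theorems.ExtinctionBuildsQCD.Negative
open Summit.QuantumFields.QCD.Theorems.TiltedFlatnessNegative

noncomputable section

section Flow

variable {n : Type*} [Fintype n]

variable [DecidableEq n]

/-- An isometric matrix (`Mᴴ M = 1`) preserves `Σ‖·‖²`. [folklore] -/
theorem sum_norm_sq_mulVec_of_isometry {M : Matrix n n ℂ} (hM : Mᴴ * M = 1) (v : n → ℂ) :
    ∑ j, ‖(M *ᵥ v) j‖ ^ 2 = ∑ j, ‖v j‖ ^ 2 := by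
  have h2 := congrArg Complex.re (star_mulVec_dotProduct_mulVec hM v)
  rw [star_dotProduct_self_eq, star_dotProduct_self_eq, Complex.ofReal_re, Complex.ofReal_re] at h2
  exact h2

/-- For a Hermitian matrix the root count with a real predicate is the eigenvalue count. [folklore] -/
theorem countP_roots_eq_card_filter {A : Matrix n n ℂ} (hA : A.IsHermitian) (p : ℝ → Prop)
    [DecidablePred p] :
    A.charpoly.roots.countP (fun z => p z.re) = (Finset.univ.filter fun i => p (hA.eigenvalues i)).card := by
  rw [countP_roots_charpoly_eq_card hA]
  congr 1

/-- Parseval for the eigenvector unitary: `Σ ‖(U† v)_j‖² = Σ ‖v_j‖²`. [folklore] -/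
theorem sum_norm_sq_eigenvectorUnitary_conjTranspose_mulVec {A : Matrix n n ℂ} (hA : A.IsHermitian)
    (v : n → ℂ) :
    ∑ j, ‖(((hA.eigenvectorUnitary : Matrix n n ℂ))ᴴ *ᵥ v) j‖ ^ 2 = ∑ j, ‖v j‖ ^ 2 := by
  refine sum_norm_sq_mulVec_of_isometry ?_ v
  rw [conjTranspose_conjTranspose, ← star_eq_conjTranspose]
  exact Unitary.coe_mul_star_self hA.eigenvectorUnitary

/-- **Counting stability (Weyl's inequality in counting form, with a sign `σ = ±1`).** Let `A`, `B` be
Hermitian with `|Re v†(B − A)v| ≤ δ Σ‖v‖²`. Then `B` has at least as many eigenvalues with `σλ < 0` as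
`A` has eigenvalues with `σλ < −δ`. Proof: on `W = {v | (U†v)_j = 0 unless σλ_j(A) < −δ}` (dimension
`≥ #{σλ(A) < −δ}` by rank–nullity) the form `σ Re v†Bv` is negative; apply the inertia bound
`card_le_card_eigenvalues_of_form_pos` to a basis of `W`. [folklore] -/
theorem card_filter_lt_neg_le {A B : Matrix n n ℂ} (hA : A.IsHermitian) (hB : B.IsHermitian) {σ δ : ℝ}
    (hσ : σ = 1 ∨ σ = -1)
    (hE : ∀ v : n → ℂ, |(star v ⬝ᵥ (B - A) *ᵥ v).re| ≤ δ * ∑ i, ‖v i‖ ^ 2) :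
    (Finset.univ.filter fun i => σ * hA.eigenvalues i < -δ).card ≤
      (Finset.univ.filter fun i => σ * hB.eigenvalues i < 0).card := by
  set U : Matrix n n ℂ := (hA.eigenvectorUnitary : Matrix n n ℂ) with hU
  let I := {i // σ * hA.eigenvalues i < -δ}
  let J := {i // ¬ σ * hA.eigenvalues i < -δ}
  let Φ : (n → ℂ) →ₗ[ℂ] (J → ℂ) :=
    (LinearMap.pi fun j : J => LinearMap.proj (R := ℂ) (φ := fun _ : n => ℂ) j.1) ∘ₗ Uᴴ.mulVecLin
  let W : Submodule ℂ (n → ℂ) := LinearMap.ker Φ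
  have hWmem : ∀ v ∈ W, ∀ j, ¬ σ * hA.eigenvalues j < -δ → (Uᴴ *ᵥ v) j = 0 := by
    intro v hv j hj
    have := congrFun (LinearMap.mem_ker.1 hv) ⟨j, hj⟩
    simpa [Φ] using this
  have hWdim : Fintype.card I ≤ Module.finrank ℂ W := by
    show Fintype.card I ≤ Module.finrank ℂ (LinearMap.ker Φ)
    have h1 := Φ.finrank_range_add_finrank_ker
    have h2 : Module.finrank ℂ (LinearMap.range Φ) ≤ Fintype.card J := by
      calc Module.finrank ℂ (LinearMap.range Φ) ≤ Module.finrank ℂ (J → ℂ) := Submodule.finrank_le _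
        _ = Fintype.card J := Module.finrank_fintype_fun_eq_card ℂ
    have h3 : Module.finrank ℂ (n → ℂ) = Fintype.card n := Module.finrank_fintype_fun_eq_card ℂ
    have h4 : Fintype.card I + Fintype.card J = Fintype.card n := by
      rw [Fintype.card_subtype_compl, Nat.add_sub_cancel' (Fintype.card_subtype_le _)]
    omega
  -- the form `σ Re v†Bv` is negative on `W`
  have hW : ∀ v ∈ W, v ≠ 0 → σ * (star v ⬝ᵥ B *ᵥ v).re < 0 := by
    intro v hv hv0
    set w := Uᴴ *ᵥ v with hw
    have hS := sum_norm_sq_eigenvectorUnitary_conjTranspose_mulVec hA v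
    rw [← hU, ← hw] at hS
    have hSpos : 0 < ∑ j, ‖w j‖ ^ 2 := by rw [hS]; exact sum_norm_sq_pos hv0
    have hqA : σ * (star v ⬝ᵥ A *ᵥ v).re < -δ * ∑ j, ‖v j‖ ^ 2 := by
      rw [re_form_eq_sum_eigenvalues hA v, ← hU, ← hw, Finset.mul_sum, ← hS, Finset.mul_sum]
      have hle : ∀ j ∈ Finset.univ, σ * (hA.eigenvalues j * ‖w j‖ ^ 2) ≤ -δ * ‖w j‖ ^ 2 := by
        intro j _
        by_cases hj : σ * hA.eigenvalues j < -δ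
        · have : σ * (hA.eigenvalues j * ‖w j‖ ^ 2) = (σ * hA.eigenvalues j) * ‖w j‖ ^ 2 := by ring
          rw [this]
          exact mul_le_mul_of_nonneg_right hj.le (by positivity)
        · have h0 : w j = 0 := by rw [hw]; exact hWmem v hv j hj
          rw [h0]; simp
      obtain ⟨j₀, hj₀⟩ : ∃ j, w j ≠ 0 := Function.ne_iff.mp (fun h => by rw [h] at hSpos; simp at hSpos)
      have hj₀I : σ * hA.eigenvalues j₀ < -δ := by
        by_contra hc
        exact hj₀ (by rw [hw]; exact hWmem v hv j₀ hc)
      have hlt : σ * (hA.eigenvalues j₀ * ‖w j₀‖ ^ 2) < -δ * ‖w j₀‖ ^ 2 := by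
        have : σ * (hA.eigenvalues j₀ * ‖w j₀‖ ^ 2) = (σ * hA.eigenvalues j₀) * ‖w j₀‖ ^ 2 := by ring
        rw [this]
        exact mul_lt_mul_of_pos_right hj₀I (by positivity)
      exact Finset.sum_lt_sum hle ⟨j₀, Finset.mem_univ _, hlt⟩
    have hEv := hE v
    have hBv : (star v ⬝ᵥ B *ᵥ v).re = (star v ⬝ᵥ A *ᵥ v).re + (star v ⬝ᵥ (B - A) *ᵥ v).re := by
      rw [sub_mulVec, dotProduct_sub, Complex.sub_re]; ring
    rw [hBv, mul_add]
    have : σ * (star v ⬝ᵥ (B - A) *ᵥ v).re ≤ δ * ∑ i, ‖v i‖ ^ 2 := by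
      rcases hσ with rfl | rfl
      · rw [one_mul]; exact (le_abs_self _).trans hEv
      · rw [neg_one_mul]; exact (neg_le_abs _).trans hEv
    linarith
  -- inertia bound applied to a basis of `W`
  set d := Module.finrank ℂ W with hd
  let b := Module.finBasis ℂ W
  let E : (Fin d → ℂ) →ₗ[ℂ] (n → ℂ) := W.subtype ∘ₗ (b.equivFun.symm : (Fin d → ℂ) →ₗ[ℂ] W)
  have hEpos : ∀ c : Fin d → ℂ, c ≠ 0 → 0 < (-σ) * (star (E c) ⬝ᵥ (B *ᵥ E c)).re := by
    intro c hc
    have hmem : E c ∈ W := (b.equivFun.symm c).2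
    have hne : E c ≠ 0 := by
      intro h0
      apply hc
      change ((b.equivFun.symm c : W) : n → ℂ) = 0 at h0
      have h1 : b.equivFun.symm c = 0 := Subtype.ext h0
      have h2 := congrArg b.equivFun h1
      rwa [LinearEquiv.apply_symm_apply, map_zero] at h2
    have := hW (E c) hmem hne
    nlinarith
  have h := card_le_card_eigenvalues_of_form_pos hB (-σ) E hEpos
  rw [Fintype.card_fin] at h
  calc (Finset.univ.filter fun i => σ * hA.eigenvalues i < -δ).card = Fintype.card I := by
        rw [Fintype.card_subtype]
    _ ≤ d := hWdim
    _ ≤ (Finset.univ.filter fun i => 0 < -σ * hB.eigenvalues i).card := h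
    _ = (Finset.univ.filter fun i => σ * hB.eigenvalues i < 0).card := by
        congr 1
        exact Finset.filter_congr fun i _ => by constructor <;> intro h <;> nlinarith

end Flow

section Pencil

variable {n : Type*} [Fintype n] [DecidableEq n]

omit [DecidableEq n] in
/-- `‖v† w‖ ≤ C Σ‖v‖²` when `Σ‖w‖² ≤ C² Σ‖v‖²`. [folklore] -/
theorem norm_star_dotProduct_le_of_sq_le (v w : n → ℂ) {C : ℝ} (hC : 0 ≤ C)
    (h : ∑ i, ‖w i‖ ^ 2 ≤ C ^ 2 * ∑ i, ‖v i‖ ^ 2) :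
    ‖star v ⬝ᵥ w‖ ≤ C * ∑ i, ‖v i‖ ^ 2 := by
  have h1 : ‖star v ⬝ᵥ w‖ ≤ ∑ i, ‖v i‖ * ‖w i‖ := by
    rw [dotProduct]
    refine (norm_sum_le _ _).trans (le_of_eq (Finset.sum_congr rfl fun i _ => ?_))
    rw [norm_mul, Pi.star_apply, norm_star]
  refine h1.trans ?_
  have hcs := Finset.sum_mul_sq_le_sq_mul_sq Finset.univ (fun i => ‖v i‖) (fun i => ‖w i‖)
  have hS : 0 ≤ ∑ i, ‖v i‖ ^ 2 := Finset.sum_nonneg fun i _ => by positivity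
  have h2 : (∑ i, ‖v i‖ * ‖w i‖) ^ 2 ≤ (C * ∑ i, ‖v i‖ ^ 2) ^ 2 := by
    calc (∑ i, ‖v i‖ * ‖w i‖) ^ 2 ≤ (∑ i, ‖v i‖ ^ 2) * ∑ i, ‖w i‖ ^ 2 := hcs
      _ ≤ (∑ i, ‖v i‖ ^ 2) * (C ^ 2 * ∑ i, ‖v i‖ ^ 2) := mul_le_mul_of_nonneg_left h hS
      _ = (C * ∑ i, ‖v i‖ ^ 2) ^ 2 := by ring
  have hnn : 0 ≤ C * ∑ i, ‖v i‖ ^ 2 := mul_nonneg hC hS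
  exact (pow_le_pow_iff_left₀ (Finset.sum_nonneg fun i _ => by positivity) hnn two_ne_zero).1 h2

variable {Γ D : Matrix n n ℂ}

omit [DecidableEq n] in
/-- The pencil `Γ D + m Γ` is Hermitian for real `m` when `Γ` and `Γ D` are. [folklore] -/
theorem pencil_isHermitian (hΓ : Γᴴ = Γ) (hD : (Γ * D)ᴴ = Γ * D) (m : ℝ) :
    (Γ * D + (m : ℂ) • Γ).IsHermitian := by
  unfold Matrix.IsHermitian
  rw [conjTranspose_add, conjTranspose_smul, hD, hΓ, Complex.star_def, Complex.conj_ofReal]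

/-- `|Re v†(H(m') − H(m))v| ≤ |m' − m| Σ‖v‖²` (`Γ` unitary). [folklore] -/
theorem pencil_diff_bound (hΓ : Γᴴ = Γ) (hΓ2 : Γ * Γ = 1) (m m' : ℝ) (v : n → ℂ) :
    |(star v ⬝ᵥ ((Γ * D + (m' : ℂ) • Γ) - (Γ * D + (m : ℂ) • Γ)) *ᵥ v).re| ≤ |m' - m| * ∑ i, ‖v i‖ ^ 2 := by
  have hdiff : (Γ * D + (m' : ℂ) • Γ) - (Γ * D + (m : ℂ) • Γ) = ((m' - m : ℝ) : ℂ) • Γ := by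
    rw [add_sub_add_left_eq_sub, ← sub_smul, ← Complex.ofReal_sub]
  rw [hdiff, smul_mulVec, dotProduct_smul, smul_eq_mul]
  have hG : Γᴴ * Γ = 1 := by rw [hΓ]; exact hΓ2
  have hiso : ∑ j, ‖(Γ *ᵥ v) j‖ ^ 2 ≤ 1 ^ 2 * ∑ j, ‖v j‖ ^ 2 := by
    rw [one_pow, one_mul, sum_norm_sq_mulVec_of_isometry hG v]
  have hb := norm_star_dotProduct_le_of_sq_le v (Γ *ᵥ v) zero_le_one hiso
  calc |(((m' - m : ℝ) : ℂ) * (star v ⬝ᵥ Γ *ᵥ v)).re| ≤ ‖((m' - m : ℝ) : ℂ) * (star v ⬝ᵥ Γ *ᵥ v)‖ :=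
        Complex.abs_re_le_norm _
    _ = |m' - m| * ‖star v ⬝ᵥ Γ *ᵥ v‖ := by rw [norm_mul, Complex.norm_real, Real.norm_eq_abs]
    _ ≤ |m' - m| * (1 * ∑ i, ‖v i‖ ^ 2) := mul_le_mul_of_nonneg_left hb (abs_nonneg _)
    _ = |m' - m| * ∑ i, ‖v i‖ ^ 2 := by rw [one_mul]

/-- Trichotomy of the eigenvalue counts of a Hermitian matrix: `ν + π + κ = n`. [folklore] -/
theorem countP_neg_add_pos_add_zero {A : Matrix n n ℂ} (hA : A.IsHermitian) :
    A.charpoly.roots.countP (fun z => z.re < 0) + A.charpoly.roots.countP (fun z => 0 < z.re) +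
      A.charpoly.roots.countP (fun z => z.re = 0) = Fintype.card n := by
  rw [countP_roots_eq_card_filter hA (· < 0), countP_roots_eq_card_filter hA (0 < ·),
    countP_roots_eq_card_filter hA (· = 0)]
  have h1 := Finset.card_filter_add_card_filter_not (s := Finset.univ)
    (fun i => hA.eigenvalues i < 0)
  have h2 : (Finset.univ.filter fun i => ¬ hA.eigenvalues i < 0) =
      (Finset.univ.filter fun i => 0 < hA.eigenvalues i) ∪ (Finset.univ.filter fun i => hA.eigenvalues i = 0) := by
    ext i
    simp only [Finset.mem_filter, Finset.mem_univ, true_and, Finset.mem_union, not_lt]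
    constructor
    · intro h
      rcases h.lt_or_eq with h | h
      · exact Or.inl h
      · exact Or.inr h.symm
    · rintro (h | h)
      · exact h.le
      · exact h.ge
  have h3 : Disjoint (Finset.univ.filter fun i => 0 < hA.eigenvalues i)
      (Finset.univ.filter fun i => hA.eigenvalues i = 0) := by
    rw [Finset.disjoint_filter]
    intro i _ h1 h2
    rw [h2] at h1
    exact lt_irrefl _ h1
  rw [h2, Finset.card_union_of_disjoint h3, Finset.card_univ] at h1
  omega

/-- **Local step of the spectral flow.** For the Hermitian pencil `H(m) = ΓD + mΓ` (`Γ` a Hermitian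
unitary, `ΓD` Hermitian) and every `m` there is `ε > 0` such that for `|t| < ε`:
`ν(m) ≤ ν(m+t) ≤ ν(m) + κ(m)` and `π(m) ≤ π(m+t)`, where `ν, π, κ` count the negative, positive and zero
eigenvalues. [folklore] -/
theorem pencil_local (hΓ : Γᴴ = Γ) (hΓ2 : Γ * Γ = 1) (hD : (Γ * D)ᴴ = Γ * D) (m : ℝ) :
    ∃ ε : ℝ, 0 < ε ∧ ∀ t : ℝ, |t| < ε →
      (Γ * D + (m : ℂ) • Γ).charpoly.roots.countP (fun z => z.re < 0) ≤
          (Γ * D + ((m + t : ℝ) : ℂ) • Γ).charpoly.roots.countP (fun z => z.re < 0) ∧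
        (Γ * D + (m : ℂ) • Γ).charpoly.roots.countP (fun z => 0 < z.re) ≤
          (Γ * D + ((m + t : ℝ) : ℂ) • Γ).charpoly.roots.countP (fun z => 0 < z.re) ∧
        (Γ * D + ((m + t : ℝ) : ℂ) • Γ).charpoly.roots.countP (fun z => z.re < 0) ≤
          (Γ * D + (m : ℂ) • Γ).charpoly.roots.countP (fun z => z.re < 0) +
            (Γ * D + (m : ℂ) • Γ).charpoly.roots.countP (fun z => z.re = 0) := by
  have hA := pencil_isHermitian hΓ hD m
  -- a positive lower bound for the non-zero eigenvalues
  obtain ⟨ε, hε, hgap⟩ : ∃ ε : ℝ, 0 < ε ∧ ∀ i, hA.eigenvalues i ≠ 0 → ε ≤ |hA.eigenvalues i| := by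
    by_cases hne : (Finset.univ.filter fun i => hA.eigenvalues i ≠ 0).Nonempty
    · obtain ⟨i₀, hi₀, hmin⟩ := Finset.exists_min_image _ (fun i => |hA.eigenvalues i|) hne
      refine ⟨|hA.eigenvalues i₀|, abs_pos.2 (Finset.mem_filter.1 hi₀).2, fun i hi => hmin i ?_⟩
      exact Finset.mem_filter.2 ⟨Finset.mem_univ _, hi⟩
    · refine ⟨1, one_pos, fun i hi => ?_⟩
      exact absurd ⟨i, Finset.mem_filter.2 ⟨Finset.mem_univ _, hi⟩⟩ hne
  refine ⟨ε, hε, fun t ht => ?_⟩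
  have hB := pencil_isHermitian hΓ hD (m + t)
  have hE : ∀ v : n → ℂ, |(star v ⬝ᵥ ((Γ * D + ((m + t : ℝ) : ℂ) • Γ) - (Γ * D + (m : ℂ) • Γ)) *ᵥ v).re|
      ≤ |t| * ∑ i, ‖v i‖ ^ 2 := by
    intro v
    have := pencil_diff_bound (D := D) hΓ hΓ2 m (m + t) v
    rwa [add_sub_cancel_left] at this
  have hν := card_filter_lt_neg_le hA hB (σ := 1) (δ := |t|) (Or.inl rfl) hE
  have hπ := card_filter_lt_neg_le hA hB (σ := -1) (δ := |t|) (Or.inr rfl) hE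
  -- below the gap the shifted thresholds do not matter
  have hνA : (Finset.univ.filter fun i => 1 * hA.eigenvalues i < -|t|) =
      (Finset.univ.filter fun i => hA.eigenvalues i < 0) := by
    refine Finset.filter_congr fun i _ => ?_
    rw [one_mul]
    constructor
    · intro h; linarith [abs_nonneg t]
    · intro h
      have := hgap i h.ne
      rw [abs_of_neg h] at this
      linarith
  have hπA : (Finset.univ.filter fun i => -1 * hA.eigenvalues i < -|t|) =
      (Finset.univ.filter fun i => 0 < hA.eigenvalues i) := by
    refine Finset.filter_congr fun i _ => ?_
    rw [neg_one_mul, neg_lt_neg_iff]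
    constructor
    · intro h; linarith [abs_nonneg t]
    · intro h
      have := hgap i h.ne'
      rw [abs_of_pos h] at this
      linarith
  have hνB : (Finset.univ.filter fun i => 1 * hB.eigenvalues i < 0) =
      (Finset.univ.filter fun i => hB.eigenvalues i < 0) :=
    Finset.filter_congr fun i _ => by rw [one_mul]
  have hπB : (Finset.univ.filter fun i => -1 * hB.eigenvalues i < 0) =
      (Finset.univ.filter fun i => 0 < hB.eigenvalues i) :=
    Finset.filter_congr fun i _ => by rw [neg_one_mul, neg_lt_zero]
  rw [hνA, hνB] at hν
  rw [hπA, hπB] at hπ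
  rw [countP_roots_eq_card_filter hA (· < 0), countP_roots_eq_card_filter hB (· < 0),
    countP_roots_eq_card_filter hA (0 < ·), countP_roots_eq_card_filter hB (0 < ·),
    countP_roots_eq_card_filter hA (· = 0)]
  refine ⟨hν, hπ, ?_⟩
  have htriA := countP_neg_add_pos_add_zero hA
  have htriB := countP_neg_add_pos_add_zero hB
  rw [countP_roots_eq_card_filter hA (· < 0), countP_roots_eq_card_filter hA (0 < ·),
    countP_roots_eq_card_filter hA (· = 0)] at htriA
  rw [countP_roots_eq_card_filter hB (· < 0), countP_roots_eq_card_filter hB (0 < ·),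
    countP_roots_eq_card_filter hB (· = 0)] at htriB
  omega

/-- **Zero modes of the pencil are eigenvalues of `D`**: `κ(m) ≤` the algebraic multiplicity of `−m` as
an eigenvalue of `D` (nullity of `Γ(D + m) ≤` geometric `≤` algebraic multiplicity). [folklore] -/
theorem pencil_zero_count_le (hΓ : Γᴴ = Γ) (hΓ2 : Γ * Γ = 1) (hD : (Γ * D)ᴴ = Γ * D) (m : ℝ) :
    (Γ * D + (m : ℂ) • Γ).charpoly.roots.countP (fun z => z.re = 0) ≤
      D.charpoly.roots.count (-(m : ℂ)) := by
  have hA := pencil_isHermitian hΓ hD m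
  rw [countP_roots_eq_card_filter hA (· = 0)]
  -- #{λ = 0} = n - rank
  have hrank := hA.rank_eq_card_non_zero_eigs
  have hzero : (Finset.univ.filter fun i => hA.eigenvalues i = 0).card =
      Fintype.card n - (Γ * D + (m : ℂ) • Γ).rank := by
    rw [hrank, Fintype.card_subtype_compl, Fintype.card_subtype,
      Nat.sub_sub_self (Finset.card_le_univ _)]
  rw [hzero]
  -- rank (Γ (D + m)) = rank (D + m)
  have hfac : Γ * D + (m : ℂ) • Γ = Γ * (D + (m : ℂ) • (1 : Matrix n n ℂ)) := by
    rw [mul_add, Matrix.mul_smul, mul_one]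
  have hΓunit : IsUnit Γ.det := by
    have : IsUnit Γ := ⟨⟨Γ, Γ, hΓ2, hΓ2⟩, rfl⟩
    exact (Matrix.isUnit_iff_isUnit_det Γ).1 this
  rw [hfac, Matrix.rank_mul_eq_right_of_isUnit_det Γ _ hΓunit]
  -- rank-nullity for D + m
  have hrn := (D + (m : ℂ) • (1 : Matrix n n ℂ)).mulVecLin.finrank_range_add_finrank_ker
  rw [Module.finrank_fintype_fun_eq_card] at hrn
  have hrk : (D + (m : ℂ) • (1 : Matrix n n ℂ)).rank =
      Module.finrank ℂ (LinearMap.range (D + (m : ℂ) • (1 : Matrix n n ℂ)).mulVecLin) := rfl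
  -- ker (D + m) ≤ eigenspace D (-m)
  have hker : LinearMap.ker (D + (m : ℂ) • (1 : Matrix n n ℂ)).mulVecLin ≤
      Module.End.eigenspace (Matrix.toLin' D) (-(m : ℂ)) := by
    intro v hv
    rw [LinearMap.mem_ker, Matrix.mulVecLin_apply, add_mulVec, smul_mulVec, one_mulVec] at hv
    rw [Module.End.mem_eigenspace_iff, Matrix.toLin'_apply, neg_smul]
    exact eq_neg_of_add_eq_zero_left hv
  have hle := (Submodule.finrank_mono hker).trans (LinearMap.finrank_eigenspace_le (Matrix.toLin' D) (-(m : ℂ)))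
  rw [Matrix.charpoly_toLin', ← Polynomial.count_roots] at hle
  omega

end Pencil

end

end Summit.QuantumFields.QCD.Theorems.WindowExtinction.Negative
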